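import Literature.MathematicalPhysics.QuantumFieldTheory.CircleHaarAngle
import Literature.Probability.LatticeModels.MMPInequality
import HarnessLib

/-!
# The plane rotator on the angle cube `[0, 2π]^V` as a Ginibre model on the torus `U(1)^V`

Folklore change of variables `θ ↦ (e^{iθ_v})_v` between the two renderings of the classical XY /
plane-rotator model: integrals of `2π`-periodic integrands over the angle cube `[0,2π]^V` with
Lebesgue measure (the form `∫ ∏ dθ_v` of the physics literature) and integrals over the compact
abelian group `U(1)^V` with its Haar probability measure `torusHaar V` (the form used by the
tree's Ginibre toolkit `GinibreModel` / `GinibreInequality` and by `DisorderedXYModel`):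

* `map_exp_volume_Ioc`: `θ ↦ e^{iθ}` pushes Lebesgue measure on any period window `(t, t + 2π]`
  to `2π ·` the Haar probability measure of `U(1)` (via `ℝ → ℝ/2πℤ → U(1)` and the tree's
  `CircleHaar.map_toCircle_volume`);
* `setIntegral_angleCube_Ioc_comp_exp`, `setIntegral_angleCube_comp_exp`:
  `∫_{(t,t+2π]^V} G(e^{iθ}) dθ = ∫_{[0,2π]^V} G(e^{iθ}) dθ = (2π)^{|V|} ∫_{U(1)^V} G dHaar`;
* `rotator_twoPoint_div_eq_ginibreExpect`: for a finite family of bonds `s k → t k` and a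
  coupling `J`, the rotator two-point function
  `∫ cos(θ_x − θ_y) e^{J ∑_k cos(θ_{t k} − θ_{s k})} dθ / ∫ e^{J ∑_k cos(θ_{t k} − θ_{s k})} dθ`
  over `[0,2π]^V` is the Ginibre expectation `⟨Re χ_{y,x}⟩_J` on `U(1)^V` for the bond characters
  `χ_k = θ̄_{s k} θ_{t k}` (`diffChar`) with constant couplings `J`.

## References

* J. Ginibre, Comm. Math. Phys. 16 (1970) 310–328 (plane-rotator example). [Ginibre1970]
* S. Friedli, Y. Velenik, *Statistical Mechanics of Lattice Systems* (CUP 2017), §9.1.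
  [FriedliVelenik2017]
-/

noncomputable section

open MeasureTheory Set Finset
open scoped BigOperators ComplexConjugate
open Literature.MathematicalPhysics.QuantumFieldTheory (haarProbability)
open Literature.MathematicalPhysics.QuantumFieldTheory.CircleHaar (map_toCircle_volume pi_const_smul
  toCircle_coe)

namespace Literature.Probability.LatticeModels

/-! ### One angle: `(t, t + 2π]` versus `U(1)` -/

/-- **`θ ↦ e^{iθ}` pushes Lebesgue measure on a period window `(t, t + 2π]` to `2π` times the Haar
probability measure of `U(1)`** (`e^{iθ} = toCircle (θ mod 2π)`; `θ ↦ θ mod 2π` pushes Lebesgue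
measure on the window to the Haar measure of `ℝ/2πℤ`, `AddCircle.measurePreserving_mk`, and
`CircleHaar.map_toCircle_volume`). [folklore] -/
theorem map_exp_volume_Ioc (t : ℝ) :
    (volume.restrict (Ioc t (t + 2 * Real.pi))).map Circle.exp =
      ENNReal.ofReal (2 * Real.pi) • haarProbability Circle := by
  have hfac : (Circle.exp : ℝ → Circle) =
      AddCircle.toCircle ∘ ((↑) : ℝ → AddCircle (2 * Real.pi)) := by
    funext θ; exact (toCircle_coe θ).symm
  have hmk : Measurable (fun θ : ℝ => (θ : AddCircle (2 * Real.pi))) :=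
    (AddCircle.continuous_mk' (2 * Real.pi)).measurable
  rw [hfac, ← Measure.map_map AddCircle.continuous_toCircle.measurable hmk,
    (AddCircle.measurePreserving_mk (2 * Real.pi) t).map_eq, map_toCircle_volume]

/-- `θ ↦ e^{iθ}` is measure preserving from Lebesgue measure on `(t, t + 2π]` to
`2π • haarProbability U(1)`. [folklore] -/
theorem measurePreserving_exp_Ioc (t : ℝ) :
    MeasurePreserving Circle.exp (volume.restrict (Ioc t (t + 2 * Real.pi)))
      (ENNReal.ofReal (2 * Real.pi) • haarProbability Circle) :=
  ⟨Circle.exp.continuous.measurable, map_exp_volume_Ioc t⟩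

/-! ### The angle cube versus the torus `U(1)^V` -/

variable {V : Type*} [Fintype V]

/-- The torus Haar probability measure of `DisorderedXYModel` is the product of the Haar
probability measures `haarProbability U(1)` of `ConstructiveQFTWave0`. [folklore] -/
theorem torusHaar_eq_pi_haarProbability :
    torusHaar V = Measure.pi fun _ : V => haarProbability Circle := rfl

/-- **Angle-cube integrals are torus Haar integrals**, window form:
`∫_{(t,t+2π]^V} G((e^{iθ_v})_v) dθ = (2π)^{|V|} ∫_{U(1)^V} G dHaar` for `G` a.e.-strongly
measurable. [folklore] -/
theorem setIntegral_angleCube_Ioc_comp_exp {E : Type*} [NormedAddCommGroup E] [NormedSpace ℝ E]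
    (G : (V → Circle) → E) (hG : AEStronglyMeasurable G (torusHaar V)) (t : ℝ) :
    ∫ θ in Set.pi univ (fun _ : V => Ioc t (t + 2 * Real.pi)), G (fun v => Circle.exp (θ v)) =
      (2 * Real.pi) ^ Fintype.card V • ∫ u, G u ∂torusHaar V := by
  haveI : IsFiniteMeasure (ENNReal.ofReal (2 * Real.pi) • haarProbability Circle) :=
    Measure.smul_finite _ ENNReal.ofReal_ne_top
  have hmp : MeasurePreserving (fun θ : V → ℝ => fun v => Circle.exp (θ v))
      (Measure.pi fun _ : V => volume.restrict (Ioc t (t + 2 * Real.pi)))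
      (Measure.pi fun _ : V => ENNReal.ofReal (2 * Real.pi) • haarProbability Circle) :=
    measurePreserving_pi _ _ fun _ => measurePreserving_exp_Ioc t
  have hpi : (Measure.pi fun _ : V => ENNReal.ofReal (2 * Real.pi) • haarProbability Circle) =
      ENNReal.ofReal (2 * Real.pi) ^ Fintype.card V • torusHaar V := by
    rw [torusHaar_eq_pi_haarProbability, pi_const_smul]
  have hG' : AEStronglyMeasurable G
      (Measure.pi fun _ : V => ENNReal.ofReal (2 * Real.pi) • haarProbability Circle) := by
    rw [hpi]; exact hG.smul_measure _
  have hrestr : (volume : Measure (V → ℝ)).restrict (Set.pi univ fun _ : V => Ioc t (t + 2 * Real.pi)) =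
      Measure.pi fun _ : V => volume.restrict (Ioc t (t + 2 * Real.pi)) := by
    rw [volume_pi, Measure.restrict_pi_pi]
  rw [hrestr, ← integral_map hmp.measurable.aemeasurable (hmp.map_eq ▸ hG'), hmp.map_eq, hpi,
    integral_smul_measure, ENNReal.toReal_pow, ENNReal.toReal_ofReal (by positivity)]

/-- **Angle-cube integrals are torus Haar integrals**:
`∫_{[0,2π]^V} G((e^{iθ_v})_v) dθ = (2π)^{|V|} ∫_{U(1)^V} G dHaar` for `G` a.e.-strongly measurable
(the faces of the closed cube are Lebesgue-null). [folklore] -/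
theorem setIntegral_angleCube_comp_exp {E : Type*} [NormedAddCommGroup E] [NormedSpace ℝ E]
    (G : (V → Circle) → E) (hG : AEStronglyMeasurable G (torusHaar V)) :
    ∫ θ in Set.pi univ (fun _ : V => Icc (0 : ℝ) (2 * Real.pi)), G (fun v => Circle.exp (θ v)) =
      (2 * Real.pi) ^ Fintype.card V • ∫ u, G u ∂torusHaar V := by
  have hae : (Set.pi univ fun _ : V => Ioc (0 : ℝ) (0 + 2 * Real.pi)) =ᵐ[(volume : Measure (V → ℝ))]
      Set.pi univ fun _ : V => Icc (0 : ℝ) (2 * Real.pi) := by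
    have e : Set.Icc (fun _ : V => (0 : ℝ)) (fun _ => 2 * Real.pi) =
        Set.pi univ fun _ : V => Icc (0 : ℝ) (2 * Real.pi) := (Set.pi_univ_Icc _ _).symm
    rw [volume_pi, zero_add, ← e]
    exact Measure.univ_pi_Ioc_ae_eq_Icc
  rw [← setIntegral_congr_set hae, setIntegral_angleCube_Ioc_comp_exp G hG 0]

/-! ### The rotator on the angle cube is a Ginibre model on the torus -/

omit [Fintype V] in
/-- The two-point observable in angles: `Re χ_{y,x}(e^{iθ}) = cos(θ_x − θ_y)`. [folklore] -/
theorem reChar_diffChar_exp (x y : V) (θ : V → ℝ) :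
    reChar (diffChar y x) (fun v => Circle.exp (θ v)) = Real.cos (θ x - θ y) := by
  rw [reChar, diffChar_apply, ← Circle.exp_neg, ← Circle.exp_add, neg_add_eq_sub, Circle.coe_exp,
    Complex.exp_ofReal_mul_I_re]

omit [Fintype V] in
/-- The rotator weight in angles: for bond characters `χ_k = θ̄_{s k} θ_{t k}` with constant
couplings `J`, `ginibreWeight χ J (e^{iθ}) = exp(J ∑_k cos(θ_{t k} − θ_{s k}))`. [folklore] -/
theorem ginibreWeight_diffChar_exp {κ : Type*} [Fintype κ] (s t : κ → V) (J : ℝ) (θ : V → ℝ) :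
    ginibreWeight (fun k => diffChar (s k) (t k)) (fun _ => J) (fun v => Circle.exp (θ v)) =
      Real.exp (J * ∑ k, Real.cos (θ (t k) - θ (s k))) := by
  rw [ginibreWeight, ginibreHamiltonian, Finset.mul_sum]
  congr 1
  refine Finset.sum_congr rfl fun k _ => ?_
  rw [reChar_diffChar_exp]

/-- **The plane rotator on the angle cube is the Ginibre model on `U(1)^V`.** For a finite family
of bonds `s k → t k`, a coupling `J` and sites `x, y`:
`∫_{[0,2π]^V} cos(θ_x − θ_y) e^{J ∑_k cos(θ_{t k} − θ_{s k})} dθ / ∫_{[0,2π]^V} e^{J ∑_k cos(θ_{t k} − θ_{s k})} dθ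
= ⟨Re χ_{y,x}⟩_J`, the Ginibre expectation on the torus `U(1)^V` (Haar probability measure) for the
bond characters `χ_k = θ̄_{s k} θ_{t k}` with constant couplings `J` (the factors `(2π)^{|V|}`
cancel). [cite: Ginibre1970, main theorem with the plane-rotator example] -/
theorem rotator_twoPoint_div_eq_ginibreExpect {κ : Type*} [Fintype κ] (s t : κ → V) (J : ℝ)
    (x y : V) :
    (∫ θ in Set.pi univ (fun _ : V => Icc (0 : ℝ) (2 * Real.pi)),
        Real.cos (θ x - θ y) * Real.exp (J * ∑ k, Real.cos (θ (t k) - θ (s k)))) /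
      (∫ θ in Set.pi univ (fun _ : V => Icc (0 : ℝ) (2 * Real.pi)),
        Real.exp (J * ∑ k, Real.cos (θ (t k) - θ (s k)))) =
    ginibreExpect (torusHaar V) (fun k => diffChar (s k) (t k)) (fun _ => J)
      (reChar (diffChar y x)) := by
  set χ : κ → (V → Circle) →ₜ* Circle := fun k => diffChar (s k) (t k) with hχ
  have hwc : Continuous (ginibreWeight χ fun _ => J) := continuous_ginibreWeight χ _
  have hfc : Continuous fun u => reChar (diffChar y x) u * ginibreWeight χ (fun _ => J) u :=
    (continuous_reChar _).mul hwc
  have h1 := setIntegral_angleCube_comp_exp (V := V) _ hfc.aestronglyMeasurable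
  have h2 := setIntegral_angleCube_comp_exp (V := V) _ hwc.aestronglyMeasurable
  simp only [hχ, reChar_diffChar_exp, ginibreWeight_diffChar_exp, smul_eq_mul] at h1 h2
  rw [h1, h2, ginibreExpect, mul_div_mul_left _ _ (by positivity)]

end Literature.Probability.LatticeModels

end
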